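import Summits.KontsevichZagierPeriods.KontsevichZagierPeriods.Theorems.LinRedNormalFormArrangementNormalFormSeparateThreeHINorm
import Summits.KontsevichZagierPeriods.KontsevichZagierPeriods.Theorems.LinRedNormalFormArrangementNormalFormSeparateThreeHIBrick

/-!
# Real Taylor data of the numerator at a base point, order of vanishing and the upper power bound

(Line `janus-bands`, crux `ArrangementNormalForm`, stub `stub_separateThreeZero`, part `HIPoly` of
the termwise numerator split `separateThree_hI` under the rim condition.)

The numerator of a terminal piece read over a base point `v₀` is `∑_{i<N} Qᵢ(v₀ + u) t^i` with
`Qᵢ` real polynomials on the base plane. This part produces uniform real Taylor data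
`Qᵢ(v₀ + u) = ∑ⱼₖ c i j k (u 0)^j (u 1)^k` (`exists_pev₂_of_le`, `exists_coef_data`), so that the
numerator becomes `pev3 c (u, t)` (`psum_eq_pev3`); the ORDER `ord c` of the data (least total
degree of a non-zero coefficient); the UPPER POWER BOUND `|Qᵢ t^i| ≤ (∑ |c|) ‖(u, t)‖^{ord c}` on
the unit ball (`term_le_pow_ord`, registered as `separateThree_poly`) — every Taylor piece vanishes at
the vertex to the order of the whole numerator, because the Taylor centre passes through the
vertex; and the behaviour of the data under dilation (`pev3_dilate`).
-/

noncomputable section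

open Set MvPolynomial

namespace Summit.KontsevichZagierPeriods.ArrangementNormalForm.JanusBands

namespace SepThree

/-! ### Real Taylor data at a base point -/

/-- The exponent vector `(i, j)` on `Fin 2`. -/
def fs2 (i j : ℕ) : Fin 2 →₀ ℕ := Finsupp.single 0 i + Finsupp.single 1 j

/-- The exponent vector evaluated at `0`. -/
@[simp] theorem fs2_zero (i j : ℕ) : fs2 i j 0 = i := by simp [fs2]

/-- The exponent vector evaluated at `1`. -/
@[simp] theorem fs2_one (i j : ℕ) : fs2 i j 1 = j := by simp [fs2]

/-- Every exponent vector on `Fin 2` is an `fs2`. -/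
theorem fs2_eq (m : Fin 2 →₀ ℕ) : fs2 (m 0) (m 1) = m := by
  ext k; fin_cases k <;> simp

/-- **Real Taylor expansion at a base point**, with any prescribed bound `d` on the bidegree that
is at least the total degree of the shifted polynomial. -/
theorem exists_pev₂_of_le (q : MvPolynomial (Fin 2) ℝ) (v₀ : Fin 2 → ℝ) {d : ℕ}
    (hd : (bind₁ (fun k => X k + C (v₀ k)) q).totalDegree ≤ d) :
    ∃ c : Fin (d + 1) → Fin (d + 1) → ℝ, ∀ u : Fin 2 → ℝ,
      eval (v₀ + u) q = SepTwo.pev₂ c (u 0) (u 1) := by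
  classical
  set qs := bind₁ (fun k => X k + C (v₀ k)) q with hqs
  have hev : ∀ u : Fin 2 → ℝ, eval (v₀ + u) q = eval u qs := by
    intro u
    rw [hqs, ← coe_aeval_eq_eval u, ← coe_aeval_eq_eval]
    show (aeval (v₀ + u)) q = (aeval u) ((bind₁ fun k => X k + C (v₀ k)) q)
    have hf : (fun k => aeval u (X k + C (v₀ k))) = v₀ + u := by
      funext k
      simp [add_comm]
    rw [aeval_bind₁, hf]
  refine ⟨fun i j => coeff (fs2 i j) qs, fun u => ?_⟩
  rw [hev u, eval_eq']
  -- the support lies in the box of exponents `≤ d`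
  set box : Finset (Fin 2 →₀ ℕ) :=
    (Finset.univ : Finset (Fin (d + 1) × Fin (d + 1))).image fun ij => fs2 ij.1 ij.2 with hbox
  have hsub : qs.support ⊆ box := by
    intro m hm
    have hle := le_totalDegree hm
    rw [Finsupp.sum_fintype _ _ (fun _ => rfl), Fin.sum_univ_two] at hle
    have h0 : m 0 < d + 1 := by omega
    have h1 : m 1 < d + 1 := by omega
    rw [hbox, Finset.mem_image]
    exact ⟨(⟨m 0, h0⟩, ⟨m 1, h1⟩), Finset.mem_univ _, fs2_eq m⟩
  have hinj : Set.InjOn (fun ij : Fin (d + 1) × Fin (d + 1) => fs2 ij.1 ij.2)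
      (Finset.univ : Finset (Fin (d + 1) × Fin (d + 1))) := by
    intro a _ b _ h
    have h0 := congrArg (fun m : Fin 2 →₀ ℕ => m 0) h
    have h1 := congrArg (fun m : Fin 2 →₀ ℕ => m 1) h
    simp only [fs2_zero, fs2_one] at h0 h1
    exact Prod.ext (Fin.ext h0) (Fin.ext h1)
  rw [Finset.sum_subset hsub (fun m _ hm => by
    rw [MvPolynomial.notMem_support_iff.1 hm, zero_mul]), hbox, Finset.sum_image hinj,
    Fintype.sum_prod_type]
  simp only [SepTwo.pev₂, Fin.prod_univ_two, fs2_zero, fs2_one]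
  refine Finset.sum_congr rfl fun i _ => Finset.sum_congr rfl fun j _ => ?_
  ring

/-- **Uniform real Taylor data** for the coefficients `qᵢ`, `i < N`, at the base point `v₀`: a
common tridegree bound `d` with `N ≤ d + 1`, data vanishing in the slots `i ≥ N`. -/
theorem exists_coef_data (N : ℕ) (q : ℕ → MvPolynomial (Fin 2) ℝ) (v₀ : Fin 2 → ℝ) :
    ∃ d : ℕ, ∃ hNd : N ≤ d + 1, ∃ c : Coef d,
      (∀ (i : ℕ) (hi : i < N) (u : Fin 2 → ℝ),
        eval (v₀ + u) (q i) = SepTwo.pev₂ (c ⟨i, lt_of_lt_of_le hi hNd⟩) (u 0) (u 1)) ∧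
      ∀ i : Fin (d + 1), N ≤ (i : ℕ) → c i = 0 := by
  classical
  set D : ℕ → ℕ := fun i => (bind₁ (fun k => X k + C (v₀ k)) (q i)).totalDegree with hD
  set d : ℕ := max N ((Finset.range N).sup D) with hd
  have hNd : N ≤ d + 1 := (le_max_left _ _).trans (Nat.le_succ _)
  have hDd : ∀ i < N, D i ≤ d := fun i hi =>
    (Finset.le_sup (f := D) (Finset.mem_range.2 hi)).trans (le_max_right _ _)
  have hex : ∀ i < N, ∃ c : Fin (d + 1) → Fin (d + 1) → ℝ, ∀ u : Fin 2 → ℝ,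
      eval (v₀ + u) (q i) = SepTwo.pev₂ c (u 0) (u 1) := fun i hi =>
    exists_pev₂_of_le (q i) v₀ (hDd i hi)
  choose cc hcc using hex
  refine ⟨d, hNd, fun i => if h : (i : ℕ) < N then cc i h else 0, fun i hi u => ?_, fun i hi => ?_⟩
  · simp only [dif_pos hi]
    exact hcc i hi u
  · simp only [dif_neg (not_lt.2 hi)]

/-- Range sums as sums over `Fin (d + 1)` with vanishing tail. -/
theorem sum_range_eq_sum_fin {M : Type*} [AddCommMonoid M] (f : ℕ → M) {N d : ℕ} (h : N ≤ d + 1) :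
    ∑ i ∈ Finset.range N, f i = ∑ i : Fin (d + 1), if (i : ℕ) < N then f i else 0 := by
  rw [← Finset.sum_range (fun i => if i < N then f i else 0), Finset.sum_ite, Finset.sum_const_zero,
    add_zero]
  congr 1
  ext i
  simp only [Finset.mem_range, Finset.mem_filter]
  omega

/-- **The numerator is `pev3` of the Taylor data**: `∑_{i<N} qᵢ(v₀ + u) t^i = pev3 c (u, t)`. -/
theorem psum_eq_pev3 {N : ℕ} {q : ℕ → MvPolynomial (Fin 2) ℝ} {v₀ : Fin 2 → ℝ} {d : ℕ}
    (hNd : N ≤ d + 1) {c : Coef d}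
    (hc : ∀ (i : ℕ) (hi : i < N) (u : Fin 2 → ℝ),
      eval (v₀ + u) (q i) = SepTwo.pev₂ (c ⟨i, lt_of_lt_of_le hi hNd⟩) (u 0) (u 1))
    (hc0 : ∀ i : Fin (d + 1), N ≤ (i : ℕ) → c i = 0) (u : Fin 2 → ℝ) (t : ℝ) :
    psum N (fun i => eval (v₀ + u) (q i)) t = pev3 c (u, t) := by
  unfold psum pev3 SepTwo.pev
  rw [sum_range_eq_sum_fin _ hNd]
  refine Finset.sum_congr rfl fun i _ => ?_
  dsimp only
  by_cases hi : (i : ℕ) < N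
  · rw [if_pos hi, hc i hi u]
  · rw [if_neg hi, hc0 i (not_lt.1 hi)]
    simp [SepTwo.pev₂]

/-! ### Order of the data and the upper power bound -/

variable {d : ℕ}

/-- The non-zero coefficients. -/
def nz (c : Coef d) : Finset (Fin (d + 1) × Fin (d + 1) × Fin (d + 1)) :=
  Finset.univ.filter fun t => c t.1 t.2.1 t.2.2 ≠ 0

/-- The total degree of a coefficient slot. -/
def tdeg (t : Fin (d + 1) × Fin (d + 1) × Fin (d + 1)) : ℕ := t.1 + t.2.1 + t.2.2

/-- Membership in the non-zero coefficients. -/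
theorem mem_nz {c : Coef d} {t : Fin (d + 1) × Fin (d + 1) × Fin (d + 1)} :
    t ∈ nz c ↔ c t.1 t.2.1 t.2.2 ≠ 0 := by
  simp [nz]

/-- Data without non-zero coefficients is zero. -/
theorem eq_zero_of_nz_eq_empty {c : Coef d} (h : nz c = ∅) : c = 0 := by
  funext i j k
  by_contra hne
  have : (i, j, k) ∈ nz c := mem_nz.2 hne
  rw [h] at this
  exact absurd this (Finset.notMem_empty _)

/-- The order of the data: the least total degree of a non-zero coefficient. -/
def ord (c : Coef d) (h : (nz c).Nonempty) : ℕ := (nz c).inf' h tdeg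

/-- Non-zero coefficients have total degree at least the order. -/
theorem ord_le {c : Coef d} (h : (nz c).Nonempty) {i j k : Fin (d + 1)} (hc : c i j k ≠ 0) :
    ord c h ≤ (i : ℕ) + j + k :=
  Finset.inf'_le tdeg ((mem_nz (t := (i, j, k))).2 hc)

/-- The order is attained. -/
theorem exists_tdeg_eq_ord {c : Coef d} (h : (nz c).Nonempty) :
    ∃ i j k : Fin (d + 1), c i j k ≠ 0 ∧ (i : ℕ) + j + k = ord c h := by
  obtain ⟨t, ht, heq⟩ := Finset.exists_mem_eq_inf' h tdeg
  exact ⟨t.1, t.2.1, t.2.2, mem_nz.1 ht, heq.symm⟩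

/-- Coordinates of a point of the unit ball. -/
theorem coord_le_norm (p : (Fin 2 → ℝ) × ℝ) :
    |p.1 0| ≤ ‖p‖ ∧ |p.1 1| ≤ ‖p‖ ∧ |p.2| ≤ ‖p‖ := by
  refine ⟨?_, ?_, ?_⟩
  · rw [← Real.norm_eq_abs]; exact (norm_le_pi_norm p.1 0).trans (norm_fst_le p)
  · rw [← Real.norm_eq_abs]; exact (norm_le_pi_norm p.1 1).trans (norm_fst_le p)
  · rw [← Real.norm_eq_abs]; exact norm_snd_le p

/-- A single monomial term on the unit ball is at most `|c| ‖p‖^{ord}`. -/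
theorem monomial_term_le {c : Coef d} (h : (nz c).Nonempty) (i j k : Fin (d + 1))
    {p : (Fin 2 → ℝ) × ℝ} (hp : ‖p‖ ≤ 1) :
    |c i j k * p.1 0 ^ (j : ℕ) * p.1 1 ^ (k : ℕ) * p.2 ^ (i : ℕ)| ≤ |c i j k| * ‖p‖ ^ ord c h := by
  by_cases hc : c i j k = 0
  · simp [hc]
  · obtain ⟨hx, hy, ht⟩ := coord_le_norm p
    have hn : 0 ≤ ‖p‖ := norm_nonneg _
    rw [abs_mul, abs_mul, abs_mul, abs_pow, abs_pow, abs_pow, mul_assoc, mul_assoc]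
    refine mul_le_mul_of_nonneg_left ?_ (abs_nonneg _)
    calc |p.1 0| ^ (j : ℕ) * (|p.1 1| ^ (k : ℕ) * |p.2| ^ (i : ℕ))
        ≤ ‖p‖ ^ (j : ℕ) * (‖p‖ ^ (k : ℕ) * ‖p‖ ^ (i : ℕ)) := by gcongr
      _ = ‖p‖ ^ ((i : ℕ) + j + k) := by rw [← pow_add, ← pow_add]; congr 1; ring
      _ ≤ ‖p‖ ^ ord c h := pow_le_pow_of_le_one hn hp (ord_le h hc)

/-- The sum of the absolute values of the coefficients. -/
def cabs (c : Coef d) : ℝ := ∑ i, ∑ j, ∑ k, |c i j k|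

/-- `cabs` is non-negative. -/
theorem cabs_nonneg (c : Coef d) : 0 ≤ cabs c :=
  Finset.sum_nonneg fun _ _ => Finset.sum_nonneg fun _ _ => Finset.sum_nonneg fun _ _ => abs_nonneg _

/-- **Upper power bound.** On the unit ball every Taylor piece `Qᵢ(v₀ + u) t^i = pev₂ (c i) · t^i`
is at most `cabs c · ‖(u, t)‖^{ord c}`: the pieces vanish at the vertex to the order of the whole
numerator. -/
theorem term_le_pow_ord {c : Coef d} (h : (nz c).Nonempty) (i : Fin (d + 1))
    {p : (Fin 2 → ℝ) × ℝ} (hp : ‖p‖ ≤ 1) :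
    |SepTwo.pev₂ (c i) (p.1 0) (p.1 1) * p.2 ^ (i : ℕ)| ≤ cabs c * ‖p‖ ^ ord c h := by
  have hexp : SepTwo.pev₂ (c i) (p.1 0) (p.1 1) * p.2 ^ (i : ℕ) =
      ∑ j, ∑ k, c i j k * p.1 0 ^ (j : ℕ) * p.1 1 ^ (k : ℕ) * p.2 ^ (i : ℕ) := by
    simp only [SepTwo.pev₂, Finset.sum_mul]
  rw [hexp]
  calc |∑ j, ∑ k, c i j k * p.1 0 ^ (j : ℕ) * p.1 1 ^ (k : ℕ) * p.2 ^ (i : ℕ)|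
      ≤ ∑ j, ∑ k, |c i j k * p.1 0 ^ (j : ℕ) * p.1 1 ^ (k : ℕ) * p.2 ^ (i : ℕ)| :=
        (Finset.abs_sum_le_sum_abs _ _).trans (Finset.sum_le_sum fun j _ => Finset.abs_sum_le_sum_abs _ _)
    _ ≤ ∑ j, ∑ k, |c i j k| * ‖p‖ ^ ord c h :=
        Finset.sum_le_sum fun j _ => Finset.sum_le_sum fun k _ => monomial_term_le h i j k hp
    _ = (∑ j, ∑ k, |c i j k|) * ‖p‖ ^ ord c h := by
        rw [Finset.sum_mul]; refine Finset.sum_congr rfl fun j _ => ?_; rw [Finset.sum_mul]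
    _ ≤ cabs c * ‖p‖ ^ ord c h := by
        refine mul_le_mul_of_nonneg_right ?_ (pow_nonneg (norm_nonneg _) _)
        exact Finset.single_le_sum (f := fun i' => ∑ j, ∑ k, |c i' j k|)
          (fun _ _ => Finset.sum_nonneg fun _ _ => Finset.sum_nonneg fun _ _ => abs_nonneg _)
          (Finset.mem_univ i)

/-! ### Dilation -/

/-- The Taylor data of the dilated numerator. -/
def dilate (s : ℝ) (c : Coef d) : Coef d := fun i j k => c i j k * s ^ ((i : ℕ) + j + k)

/-- **Dilation**: `pev3 c (s • p) = pev3 (dilate s c) p`. -/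
theorem pev3_dilate (c : Coef d) (s : ℝ) (p : (Fin 2 → ℝ) × ℝ) :
    pev3 c (s • p) = pev3 (dilate s c) p := by
  simp only [pev3_eq, dilate, Prod.smul_fst, Prod.smul_snd, Pi.smul_apply, smul_eq_mul]
  refine Finset.sum_congr rfl fun i _ => Finset.sum_congr rfl fun j _ =>
    Finset.sum_congr rfl fun k _ => ?_
  rw [mul_pow, mul_pow, mul_pow, pow_add, pow_add]
  ring

/-- A coefficient of the dilated data. -/
theorem dilate_apply (s : ℝ) (c : Coef d) (i j k : Fin (d + 1)) :
    dilate s c i j k = c i j k * s ^ ((i : ℕ) + j + k) := rfl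

end SepThree

/-- **Upper power bound for the Taylor pieces at a vertex** (registered part of
`stub_separateThreeZero`; literal form of `SepThree.term_le_pow_ord`): for Taylor data `c` of
tridegree `≤ (d, d, d)` with a non-zero coefficient, every piece `(∑ⱼₖ c i j k x^j y^k) t^i` is
bounded on the unit ball of `(Fin 2 → ℝ) × ℝ` by `(∑ |c|) ‖p‖^{ord c}`, `ord c` the least total
degree of a non-zero coefficient. -/
theorem separateThree_poly {d : ℕ} (c : Fin (d + 1) → Fin (d + 1) → Fin (d + 1) → ℝ) (h : (SepThree.nz c).Nonempty) (i : Fin (d + 1)) (p : (Fin 2 → ℝ) × ℝ) (hp : ‖p‖ ≤ 1) : |(∑ j : Fin (d + 1), ∑ k : Fin (d + 1), c i j k * p.1 0 ^ (j : ℕ) * p.1 1 ^ (k : ℕ)) * p.2 ^ (i : ℕ)| ≤ (∑ i' : Fin (d + 1), ∑ j : Fin (d + 1), ∑ k : Fin (d + 1), |c i' j k|) * ‖p‖ ^ SepThree.ord c h := by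
  exact SepThree.term_le_pow_ord h i hp

end Summit.KontsevichZagierPeriods.ArrangementNormalForm.JanusBands
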